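import Mathlib
import Summits.NavierStokesRegularity.NavierStokesRegularity.Theorems.TaoLadderRungTwoBreakBlowupRigidityOneLocalLawClosure
import HarnessLib

/-!
# Closure of the renormalised lattice law with a CONVERGING DAMPING COEFFICIENT on receding WINDOWS `(a_j, b)` —
  the compactness core of the TYPE-II branch («not type I ⇒ a bounded ancient solution of the AUTONOMOUS lattice»)
  for the extraction cruxes K2(1) `BlowupRigidityOne` (stmt-NavierStokesRegularity-20206) / K2ᵛ(1) ⟨20420⟩

MODEL lattice ODEs only (Tao 2016 §4 (4.8)/(4.12), §6.4); nothing here is a statement about the Navier–Stokes equations;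
NO item is closed (`--supports stmt-NavierStokesRegularity-20206`). Route-independent; general `m`.

The type-I extraction (`eternalLawLimit_of_typeI`) rescales by the FIXED self-similar rate; when type I FAILS (cell risk N-39,
the open stub `stub_typeOne` of ⟨20420⟩) the classical alternative (Giga–Kohn / Hamilton point-picking) rescales the
renormalised flow by its own running maximum `M_j → ∞`: `V_j(n, s) = M_j⁻¹ W̃_{n+n_j}(σ_j + s/M_j)` solves the SAME lattice law
with damping coefficient `c_j = 1/M_j → 0` on a window `(a_j, b]` (`a_j → -∞`), and a limit solves the AUTONOMOUS law
`V' = Q(V) + Λ A(V_{·-1}) + Λ⁻¹ B(V_{·+1}, V)` — the exact cascade in the critical variables `y_n = Λ^n x_n`. This file is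
the ODE-closure step in that generality:

* `dampedLaw_of_continuousLimit_window` — laws `V_j' = -c_j V_j + Q + ΛA + Λ⁻¹B` on `(a_j, b)`, `a_j → -∞`, `c_j → c_∞`, local
  window bounds, continuous convergence at points `σ < b` ⇒ the limit solves `W' = -c_∞ W + Q + ΛA + Λ⁻¹B` at every `σ < b`
  (`c_∞ = 1`: the eternal law of `IsEternal`; `c_∞ = 0`: the autonomous lattice).

HONEST LABEL: a compactness lemma; the point-picking selection («not type I ⇒ a dominating sequence») and the Liouville
question for bounded ancient solutions of the autonomous lattice are NOT addressed here. No stub, crux or summit is proved.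
-/

noncomputable section

-- the summit and its single sub-problem share the name (CONVENTIONS §1)
set_option linter.dupNamespace false

open Set Filter Topology MeasureTheory

namespace Summit.NavierStokesRegularity.NavierStokesRegularity.Theorems

namespace BlowupRigidityOne

open Literature.Analysis.FluidPDE Literature.Analysis.FluidPDE.TaoCascade
open Summit.NavierStokesRegularity.NavierStokesRegularity.Cruxes.MinimalBlowupExtraction.TableCont
  (tendsto_tableQ_comp tendsto_tableA_comp tendsto_tableB_comp)
open TransitMassLedgerEnergy (continuous_tableQ continuous_tableA)

variable {m : ℕ}

/-- **CLOSURE WITH CONVERGING DAMPING ON RECEDING WINDOWS.** Let `V_j : ℤ → ℝ → ℝ^m` satisfy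
`V_j' = -(c_j • V_j) + Q(V_j) + Λ A(V_j(·-1)) + Λ⁻¹ B(V_j(·+1), V_j)` on `(a_j, b)` with `a_j → -∞`, `c_j → c_∞`, and
suppose for every shell `n` and every `a'` some bound `‖V_j n u‖ ≤ B` holds on `[a', b)` eventually in `j`. If the `V_j`
converge continuously to `W` at every `σ < b`, then `W` solves `W' = -(c_∞ • W) + Q(W) + Λ A(W(·-1)) + Λ⁻¹ B(W(·+1), W)`
at every `σ < b`. [cite: Tao2016AveragedNS, §4 Lemma 4.1 (iii) (4.8), §6.4; Teschl2012, §2.6; cell vocabulary] -/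
theorem dampedLaw_of_continuousLimit_window {ε₀ : ℝ} {α : Fin m → Fin m → Fin m → ℤ × ℤ × ℤ → ℝ}
    {V : ℕ → ℤ → ℝ → Em m} {a : ℕ → ℝ} {b : ℝ} {c : ℕ → ℝ} {cinf : ℝ}
    (hlaw : ∀ (j : ℕ) (n : ℤ) (u : ℝ), a j < u → u < b → HasDerivAt (V j n)
      (-(c j • V j n u) + tableQ α (V j n u) + bigLam ε₀ • tableA α (V j (n - 1) u)
        + (bigLam ε₀)⁻¹ • tableB α (V j (n + 1) u) (V j n u)) u)
    (hbd : ∀ (n : ℤ) (a' : ℝ), ∃ B : ℝ, ∀ᶠ j in atTop, ∀ u : ℝ, a' ≤ u → u < b → ‖V j n u‖ ≤ B)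
    (ha : Tendsto a atTop atBot) (hc : Tendsto c atTop (𝓝 cinf)) {W : ℤ → ℝ → Em m}
    (hconv : ∀ (n : ℤ) (u : ℕ → ℝ) (σ : ℝ), σ < b → Tendsto u atTop (𝓝 σ) →
      Tendsto (fun j => V j n (u j)) atTop (𝓝 (W n σ)))
    (n : ℤ) {σ : ℝ} (hσb : σ < b) :
    HasDerivAt (W n) (-(cinf • W n σ) + tableQ α (W n σ) + bigLam ε₀ • tableA α (W (n - 1) σ)
        + (bigLam ε₀)⁻¹ • tableB α (W (n + 1) σ) (W n σ)) σ := by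
  -- pointwise limits below `b`
  have hpt : ∀ (k : ℤ) (u : ℝ), u < b → Tendsto (fun j => V j k u) atTop (𝓝 (W k u)) := fun k u hu =>
    hconv k (fun _ => u) u hu tendsto_const_nhds
  -- the damping coefficients are eventually bounded by `|c_∞| + 1`
  have hcB : ∀ᶠ j in atTop, |c j| ≤ |cinf| + 1 := by
    refine ((Metric.tendsto_nhds.1 hc) 1 one_pos).mono fun j hj => ?_
    rw [Real.dist_eq] at hj
    calc |c j| = |cinf + (c j - cinf)| := by ring_nf
      _ ≤ |cinf| + |c j - cinf| := abs_add_le _ _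
      _ ≤ |cinf| + 1 := by linarith
  -- LOCAL bounds on `[a', b)`: shells `k, k±1` and the damped field at shell `k`, eventually
  have hloc : ∀ (k : ℤ) (a' : ℝ), ∃ K : ℝ, 0 ≤ K ∧ ∀ᶠ j in atTop, a j < a' ∧ ∀ u : ℝ, a' ≤ u → u < b →
      ‖V j k u‖ ≤ K ∧
      ‖-(c j • V j k u) + tableQ α (V j k u) + bigLam ε₀ • tableA α (V j (k - 1) u)
        + (bigLam ε₀)⁻¹ • tableB α (V j (k + 1) u) (V j k u)‖ ≤ K := by
    intro k a'
    obtain ⟨B₀, h₀⟩ := hbd k a'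
    obtain ⟨B₁, h₁⟩ := hbd (k - 1) a'
    obtain ⟨B₂, h₂⟩ := hbd (k + 1) a'
    set Bm : ℝ := max (max B₀ B₁) (max B₂ 0) with hBm
    have hB0 : B₀ ≤ Bm := (le_max_left _ _).trans (le_max_left _ _)
    have hB1 : B₁ ≤ Bm := (le_max_right _ _).trans (le_max_left _ _)
    have hB2 : B₂ ≤ Bm := (le_max_left _ _).trans (le_max_right _ _)
    have hBm0 : 0 ≤ Bm := (le_max_right _ _).trans (le_max_right _ _)
    set K₁ : ℝ := Bm + shiftConst α (0, 0, 0) * Bm ^ 2 + ‖bigLam ε₀‖ * (shiftConst α (0, 0, 1) * Bm ^ 2)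
      + ‖(bigLam ε₀)⁻¹‖ * ((shiftConst α (1, 0, 0) + shiftConst α (0, 1, 0)) * Bm * Bm) with hK₁
    have hBK : Bm ≤ K₁ := by
      have h1 : 0 ≤ shiftConst α (0, 0, 0) * Bm ^ 2 := mul_nonneg (shiftConst_nonneg α _) (sq_nonneg _)
      have h2 : 0 ≤ ‖bigLam ε₀‖ * (shiftConst α (0, 0, 1) * Bm ^ 2) :=
        mul_nonneg (norm_nonneg _) (mul_nonneg (shiftConst_nonneg α _) (sq_nonneg _))
      have h3 : 0 ≤ ‖(bigLam ε₀)⁻¹‖ * ((shiftConst α (1, 0, 0) + shiftConst α (0, 1, 0)) * Bm * Bm) :=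
        mul_nonneg (norm_nonneg _) (mul_nonneg (mul_nonneg
          (add_nonneg (shiftConst_nonneg α _) (shiftConst_nonneg α _)) hBm0) hBm0)
      rw [hK₁]; linarith
    set K : ℝ := K₁ + (|cinf| + 2) * Bm with hK
    have hK0 : 0 ≤ K := by
      have : 0 ≤ (|cinf| + 2) * Bm := mul_nonneg (by positivity) hBm0
      rw [hK]; linarith [hBm0.trans hBK]
    refine ⟨K, hK0, ?_⟩
    filter_upwards [h₀, h₁, h₂, ha.eventually (eventually_lt_atBot a'), hcB] with j hj₀ hj₁ hj₂ hja hjc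
    refine ⟨hja, fun u hu hub => ⟨(hj₀ u hu hub).trans (hB0.trans ?_), ?_⟩⟩
    · have : 0 ≤ (|cinf| + 2) * Bm := mul_nonneg (by positivity) hBm0
      rw [hK]; linarith
    have hx : ‖V j k u‖ ≤ Bm := (hj₀ u hu hub).trans hB0
    have hrhs := norm_eternalLaw_rhs_le ε₀ α hBm0 hx ((hj₁ u hu hub).trans hB1) ((hj₂ u hu hub).trans hB2)
    have e : -(c j • V j k u) + tableQ α (V j k u) + bigLam ε₀ • tableA α (V j (k - 1) u)
        + (bigLam ε₀)⁻¹ • tableB α (V j (k + 1) u) (V j k u) =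
        (-((1 : ℝ) • V j k u) + tableQ α (V j k u) + bigLam ε₀ • tableA α (V j (k - 1) u)
          + (bigLam ε₀)⁻¹ • tableB α (V j (k + 1) u) (V j k u)) + (1 - c j) • V j k u := by
      rw [sub_smul, one_smul]; abel
    rw [e]
    have hdamp : ‖(1 - c j) • V j k u‖ ≤ (|cinf| + 2) * Bm := by
      rw [norm_smul, Real.norm_eq_abs]
      have : |1 - c j| ≤ |cinf| + 2 := by
        calc |1 - c j| ≤ |(1 : ℝ)| + |c j| := abs_sub _ _
          _ ≤ 1 + (|cinf| + 1) := by rw [abs_one]; linarith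
          _ = |cinf| + 2 := by ring
      exact mul_le_mul this hx (norm_nonneg _) (by positivity)
    calc _ ≤ ‖-((1 : ℝ) • V j k u) + tableQ α (V j k u) + bigLam ε₀ • tableA α (V j (k - 1) u)
          + (bigLam ε₀)⁻¹ • tableB α (V j (k + 1) u) (V j k u)‖ + ‖(1 - c j) • V j k u‖ := norm_add_le _ _
      _ ≤ K₁ + (|cinf| + 2) * Bm := add_le_add hrhs hdamp
  -- eventually, each `V j k` is `K`-Lipschitz on `[a', b)`
  have hlipV : ∀ (k : ℤ) (a' : ℝ), ∃ K : ℝ, 0 ≤ K ∧ ∀ᶠ j in atTop, ∀ u v : ℝ, a' ≤ u → u ≤ v → v < b →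
      ‖V j k v - V j k u‖ ≤ K * (v - u) := by
    intro k a'
    obtain ⟨K, hK0, hev⟩ := hloc k a'
    refine ⟨K, hK0, hev.mono fun j hj u v hu huv hvb => ?_⟩
    obtain ⟨hja, hj⟩ := hj
    have hderiv : ∀ τ ∈ Icc u v, HasDerivWithinAt (V j k)
        (-(c j • V j k τ) + tableQ α (V j k τ) + bigLam ε₀ • tableA α (V j (k - 1) τ)
          + (bigLam ε₀)⁻¹ • tableB α (V j (k + 1) τ) (V j k τ)) (Icc u v) τ := fun τ hτ =>
      (hlaw j k τ (by linarith [hτ.1]) (by linarith [hτ.2])).hasDerivWithinAt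
    have hbound : ∀ τ ∈ Ico u v,
        ‖-(c j • V j k τ) + tableQ α (V j k τ) + bigLam ε₀ • tableA α (V j (k - 1) τ)
          + (bigLam ε₀)⁻¹ • tableB α (V j (k + 1) τ) (V j k τ)‖ ≤ K := fun τ hτ =>
      (hj τ (hu.trans hτ.1) (lt_trans hτ.2 hvb)).2
    exact norm_image_sub_le_of_norm_deriv_le_segment' hderiv hbound v (right_mem_Icc.2 huv)
  -- hence `W k` is Lipschitz on every `[a', b)`, in particular continuous at every `σ < b`
  have hlipW : ∀ (k : ℤ) (a' : ℝ), ∃ K : ℝ, 0 ≤ K ∧ ∀ u v : ℝ, a' ≤ u → u ≤ v → v < b →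
      ‖W k v - W k u‖ ≤ K * (v - u) := by
    intro k a'
    obtain ⟨K, hK0, hev⟩ := hlipV k a'
    exact ⟨K, hK0, fun u v hu huv hvb =>
      le_of_tendsto ((hpt k v hvb).sub (hpt k u (lt_of_le_of_lt huv hvb))).norm
        (hev.mono fun j hj => hj u v hu huv hvb)⟩
  have hWcont : ∀ (k : ℤ) (σ₀ : ℝ), σ₀ < b → ContinuousAt (W k) σ₀ := by
    intro k σ₀ hσ₀
    obtain ⟨K, hK0, hK⟩ := hlipW k (σ₀ - 1)
    have hL : LipschitzOnWith K.toNNReal (W k) (Icc (σ₀ - 1) ((σ₀ + b) / 2)) := by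
      refine LipschitzOnWith.of_dist_le' fun x hx y hy => ?_
      rw [dist_eq_norm, Real.dist_eq]
      rcases le_total x y with hxy | hxy
      · rw [norm_sub_rev, abs_sub_comm, abs_of_nonneg (by linarith)]
        exact hK x y hx.1 hxy (by linarith [hy.2])
      · rw [abs_of_nonneg (by linarith)]
        exact hK y x hy.1 hxy (by linarith [hx.2])
    exact hL.continuousOn.continuousAt (Icc_mem_nhds (by linarith) (by linarith))
  -- the limiting field is continuous at every point below `b`
  have hΦat : ∀ u : ℝ, u < b → ContinuousAt (fun v => -(cinf • W n v) + tableQ α (W n v)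
      + bigLam ε₀ • tableA α (W (n - 1) v) + (bigLam ε₀)⁻¹ • tableB α (W (n + 1) v) (W n v)) u := by
    intro u hu
    have hQ : ContinuousAt (fun v => tableQ α (W n v)) u := tendsto_tableQ_comp α (hWcont n u hu)
    have hA : ContinuousAt (fun v => tableA α (W (n - 1) v)) u := tendsto_tableA_comp α (hWcont (n - 1) u hu)
    have hBB : ContinuousAt (fun v => tableB α (W (n + 1) v) (W n v)) u :=
      tendsto_tableB_comp α (hWcont (n + 1) u hu) (hWcont n u hu)
    refine ContinuousAt.add (ContinuousAt.add (ContinuousAt.add ?_ hQ) ?_) ?_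
    · exact ContinuousAt.neg (ContinuousAt.const_smul (hWcont n u hu) cinf)
    · exact ContinuousAt.const_smul hA (bigLam ε₀)
    · exact ContinuousAt.const_smul hBB ((bigLam ε₀)⁻¹)
  have hΦon : ContinuousOn (fun v => -(cinf • W n v) + tableQ α (W n v)
      + bigLam ε₀ • tableA α (W (n - 1) v) + (bigLam ε₀)⁻¹ • tableB α (W (n + 1) v) (W n v)) (Iio b) :=
    fun u hu => (hΦat u hu).continuousWithinAt
  -- the fields along `V j` are continuous on `(a j, b)`
  have hcontV : ∀ (j : ℕ) (k : ℤ) (u : ℝ), a j < u → u < b → ContinuousAt (V j k) u := fun j k u hu hub =>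
    (hlaw j k u hu hub).continuousAt
  have hcontF : ∀ (j : ℕ) (u : ℝ), a j < u → u < b → ContinuousAt (fun v => -(c j • V j n v)
      + tableQ α (V j n v) + bigLam ε₀ • tableA α (V j (n - 1) v)
      + (bigLam ε₀)⁻¹ • tableB α (V j (n + 1) v) (V j n v)) u := by
    intro j u hu hub
    have hQ : ContinuousAt (fun v => tableQ α (V j n v)) u := tendsto_tableQ_comp α (hcontV j n u hu hub)
    have hA : ContinuousAt (fun v => tableA α (V j (n - 1) v)) u :=
      tendsto_tableA_comp α (hcontV j (n - 1) u hu hub)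
    have hBB : ContinuousAt (fun v => tableB α (V j (n + 1) v) (V j n v)) u :=
      tendsto_tableB_comp α (hcontV j (n + 1) u hu hub) (hcontV j n u hu hub)
    refine ContinuousAt.add (ContinuousAt.add (ContinuousAt.add ?_ hQ) ?_) ?_
    · exact ContinuousAt.neg (ContinuousAt.const_smul (hcontV j n u hu hub) (c j))
    · exact ContinuousAt.const_smul hA (bigLam ε₀)
    · exact ContinuousAt.const_smul hBB ((bigLam ε₀)⁻¹)
  -- pointwise convergence of the fields below `b`
  have hFlim : ∀ u : ℝ, u < b → Tendsto (fun j => -(c j • V j n u) + tableQ α (V j n u)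
      + bigLam ε₀ • tableA α (V j (n - 1) u) + (bigLam ε₀)⁻¹ • tableB α (V j (n + 1) u) (V j n u)) atTop
      (𝓝 (-(cinf • W n u) + tableQ α (W n u) + bigLam ε₀ • tableA α (W (n - 1) u)
        + (bigLam ε₀)⁻¹ • tableB α (W (n + 1) u) (W n u))) := by
    intro u hu
    have hQ := tendsto_tableQ_comp α (hpt n u hu)
    have hA := tendsto_tableA_comp α (hpt (n - 1) u hu)
    have hBB := tendsto_tableB_comp α (hpt (n + 1) u hu) (hpt n u hu)
    refine Tendsto.add (Tendsto.add (Tendsto.add ?_ hQ) ?_) ?_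
    · exact Tendsto.neg (Tendsto.smul hc (hpt n u hu))
    · exact Tendsto.const_smul hA (bigLam ε₀)
    · exact Tendsto.const_smul hBB ((bigLam ε₀)⁻¹)
  -- integral form in the limit on `[σ₀, σ'] ⊂ (-∞, b)`
  have hint : ∀ σ₀ σ' : ℝ, σ₀ ≤ σ' → σ' < b →
      ∫ u in σ₀..σ', (-(cinf • W n u) + tableQ α (W n u) + bigLam ε₀ • tableA α (W (n - 1) u)
        + (bigLam ε₀)⁻¹ • tableB α (W (n + 1) u) (W n u)) = W n σ' - W n σ₀ := by
    intro σ₀ σ' hle hσ'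
    obtain ⟨K, hK0, hev⟩ := hloc n σ₀
    have hframe : ∀ᶠ j in atTop,
        ∫ u in σ₀..σ', (-(c j • V j n u) + tableQ α (V j n u) + bigLam ε₀ • tableA α (V j (n - 1) u)
          + (bigLam ε₀)⁻¹ • tableB α (V j (n + 1) u) (V j n u)) = V j n σ' - V j n σ₀ := by
      refine hev.mono fun j hj => ?_
      obtain ⟨hja, -⟩ := hj
      refine intervalIntegral.integral_eq_sub_of_hasDerivAt (fun u hu => ?_) ?_
      · rw [uIcc_of_le hle] at hu
        exact hlaw j n u (lt_of_lt_of_le hja hu.1) (lt_of_le_of_lt hu.2 hσ')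
      · refine ContinuousOn.intervalIntegrable ?_
        rw [uIcc_of_le hle]
        exact fun u hu => (hcontF j u (lt_of_lt_of_le hja hu.1) (lt_of_le_of_lt hu.2 hσ')).continuousWithinAt
    have hlim : Tendsto (fun j => ∫ u in σ₀..σ', (-(c j • V j n u) + tableQ α (V j n u)
        + bigLam ε₀ • tableA α (V j (n - 1) u) + (bigLam ε₀)⁻¹ • tableB α (V j (n + 1) u) (V j n u))) atTop
        (𝓝 (∫ u in σ₀..σ', (-(cinf • W n u) + tableQ α (W n u) + bigLam ε₀ • tableA α (W (n - 1) u)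
          + (bigLam ε₀)⁻¹ • tableB α (W (n + 1) u) (W n u)))) := by
      refine intervalIntegral.tendsto_integral_filter_of_dominated_convergence (fun _ => K)
        ?_ ?_ intervalIntegrable_const ?_
      · refine hev.mono fun j hj => ContinuousOn.aestronglyMeasurable (fun u hu => ?_) measurableSet_uIoc
        rw [Set.uIoc_of_le hle] at hu
        exact (hcontF j u (lt_trans hj.1 hu.1) (lt_of_le_of_lt hu.2 hσ')).continuousWithinAt
      · refine hev.mono fun j hj => ae_of_all _ fun u hu => ?_
        rw [Set.uIoc_of_le hle] at hu
        exact (hj.2 u hu.1.le (lt_of_le_of_lt hu.2 hσ')).2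
      · refine ae_of_all _ fun u hu => ?_
        rw [Set.uIoc_of_le hle] at hu
        exact hFlim u (lt_of_le_of_lt hu.2 hσ')
    exact tendsto_nhds_unique (hlim.congr' hframe) ((hpt n σ' hσ').sub (hpt n σ₀ (lt_of_le_of_lt hle hσ')))
  -- FTC-2 at `σ`, from the base point `σ - 1`, inside `(-∞, b)`
  have hIcc : uIcc (σ - 1) σ ⊆ Iio b := by
    rw [uIcc_of_le (by linarith)]; exact fun u hu => lt_of_le_of_lt hu.2 hσb
  have hG : HasDerivAt (fun s => W n (σ - 1) + ∫ u in (σ - 1)..s, (-(cinf • W n u) + tableQ α (W n u)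
      + bigLam ε₀ • tableA α (W (n - 1) u) + (bigLam ε₀)⁻¹ • tableB α (W (n + 1) u) (W n u)))
      (-(cinf • W n σ) + tableQ α (W n σ) + bigLam ε₀ • tableA α (W (n - 1) σ)
        + (bigLam ε₀)⁻¹ • tableB α (W (n + 1) σ) (W n σ)) σ := by
    have h := intervalIntegral.integral_hasDerivAt_right ((hΦon.mono hIcc).intervalIntegrable)
      (hΦon.stronglyMeasurableAtFilter isOpen_Iio σ hσb) (hΦat σ hσb) (a := σ - 1) (b := σ)
    exact h.const_add _
  have heq : W n =ᶠ[𝓝 σ] fun s => W n (σ - 1) + ∫ u in (σ - 1)..s, (-(cinf • W n u) + tableQ α (W n u)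
      + bigLam ε₀ • tableA α (W (n - 1) u) + (bigLam ε₀)⁻¹ • tableB α (W (n + 1) u) (W n u)) := by
    filter_upwards [Ioo_mem_nhds (show σ - 1 < σ by linarith) hσb] with s hs
    rw [hint (σ - 1) s hs.1.le hs.2]
    abel
  exact hG.congr_of_eventuallyEq heq

end BlowupRigidityOne

end Summit.NavierStokesRegularity.NavierStokesRegularity.Theorems

end
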